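import Summits.HodgeConjecture.CorCM.GaloisSixteenStructure
import HarnessLib

/-!
# Structure of the groups of order `16` with a central involution, II: exponent `4` with a square outside `{1, c}`

COR-CM (cell `pub-hodgecm2`), binder seat b04 (gen 17), count-neutral claim GALOIS16-COMPLETE.  KERNEL ONLY:
theorems; no definition, no named fact, no `sorry`.  `HC_CM` is neither used nor claimed.  Pure, classification-free
group theory, continuing `GaloisSixteenStructure`.

**`structure_of_pow_four`.**  Let `|G| = 16`, every element satisfy `u⁴ = 1`, `c ≠ 1` be a central involution,
`G` be non-commutative and `g` an element with `g² ∉ {1, c}`.  Then `g` has order `4`, `c ∉ ⟨g⟩`,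
`A = ⟨g, c⟩ ≅ C₄ × C₂` has index `2`, and any `s ∉ A` satisfies `s g = g^{a₁} c^{b₁} s`, `s² = g^{a₂} c^{b₂}` with
`a₁` odd, `(a₁, b₁) ≠ (1, 0)` and `a₂` even; moreover `gⁱ cʲ s ≠ 1` — exactly the hypotheses of
`GaloisTableLaws.exists_table_lawE`, with twelve possible parameters `(a₁,b₁,a₂,b₂)`, all realised
(`D₄ × C₂`, `Q₈ × C₂` with `c` outside the square class, `C₄ ⋊ C₄`, `(C₄ × C₂) ⋊ C₂`;
`GaloisSixteenDegenerateTablesE30/E11/E31`).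

## References

* [Dodson1984] B. Dodson, *The structure of Galois groups of CM-fields*, Trans. AMS 283 (1984), §5.2, §5.3.1.
* [Shimura1998] G. Shimura, *Abelian Varieties with Complex Multiplication and Modular Functions*, §8.1.
-/

namespace Summit.HodgeConjecture.CorCM.GaloisSixteenStructure

open Summit.HodgeConjecture.CorCM.GaloisTableLaws

variable {G : Type*} [Group G]

/-- **Normal form in exponent `4` with a square outside `{1, c}`** (see the module docstring). [folklore] -/
theorem structure_of_pow_four [Finite G] (hcard : Nat.card G = 16) (c : G) (hc1 : c ≠ 1) (hcc : c * c = 1)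
    (hcz : ∀ u : G, u * c = c * u) (h4 : ∀ u : G, u ^ 4 = 1) (a b : G) (hab : a * b ≠ b * a) (g : G)
    (hg1 : g * g ≠ 1) (hgc : g * g ≠ c) :
    ∃ (s : G) (a₁ b₁ a₂ b₂ : ℕ), a₁ < 4 ∧ b₁ < 2 ∧ a₂ < 4 ∧ b₂ < 2 ∧ orderOf g = 4 ∧
      c ∉ Subgroup.zpowers g ∧ (∀ i j : ℕ, g ^ i * c ^ j * s ≠ 1) ∧ s * c = c * s ∧
      s * g = g ^ a₁ * c ^ b₁ * s ∧ s * s = g ^ a₂ * c ^ b₂ ∧ a₁ % 2 = 1 ∧ ¬ (a₁ = 1 ∧ b₁ = 0) ∧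
      a₂ % 2 = 0 := by
  have hc2 : c ^ 2 = 1 := by rw [pow_two, hcc]
  have hgne : g ≠ 1 := fun h => hg1 (by rw [h, one_mul])
  have hg : orderOf g = 4 := orderOf_eq_four (h4 g) hgne hg1
  have hg4 : g ^ 4 = 1 := h4 g
  have hgcomm : g * c = c * g := hcz g
  have hcpow : ∀ (m n : ℕ), c ^ m * g ^ n = g ^ n * c ^ m := fun m n => (Commute.pow_pow hgcomm n m).eq.symm
  -- `c ∉ ⟨g⟩`
  have hcg : c ∉ Subgroup.zpowers g := by
    intro h
    obtain ⟨k, hk, hck⟩ := exists_pow_lt_of_mem_zpowers h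
    rw [hg] at hk
    interval_cases k
    · exact hc1 (by rw [hck, pow_zero])
    · rw [pow_one] at hck
      exact hg1 (by rw [← hck, hcc])
    · exact hgc (by rw [hck, pow_two])
    · apply hg1
      have h6 : c * c = g ^ 6 := by rw [hck, ← pow_add]
      rw [hcc, show (6 : ℕ) = 4 + 2 by norm_num, pow_add, hg4, one_mul, pow_two] at h6
      exact h6.symm
  -- `A = ⟨g, c⟩` and its words
  set A := Subgroup.closure ({g, c} : Set G) with hA_def
  have hmemg : g ∈ A := Subgroup.subset_closure (by simp)
  have hmemc : c ∈ A := Subgroup.subset_closure (by simp)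
  have hword_mul : ∀ i j i' j' : ℕ, (g ^ i * c ^ j) * (g ^ i' * c ^ j') = g ^ (i + i') * c ^ (j + j') := by
    intro i j i' j'
    rw [mul_assoc, ← mul_assoc (c ^ j), hcpow j i', mul_assoc, ← pow_add, ← mul_assoc, ← pow_add]
  have hA : ∀ u ∈ A, ∃ i j : ℕ, u = g ^ i * c ^ j := by
    intro u hu
    induction hu using Subgroup.closure_induction with
    | mem z hz =>
      simp only [Set.mem_insert_iff, Set.mem_singleton_iff] at hz
      rcases hz with rfl | rfl
      · exact ⟨1, 0, by simp⟩
      · exact ⟨0, 1, by simp⟩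
    | one => exact ⟨0, 0, by simp⟩
    | mul u v _ _ ihu ihv =>
      obtain ⟨i, j, rfl⟩ := ihu
      obtain ⟨i', j', rfl⟩ := ihv
      exact ⟨_, _, hword_mul i j i' j'⟩
    | inv u _ ihu =>
      obtain ⟨i, j, rfl⟩ := ihu
      have hinv : (g ^ i * c ^ j)⁻¹ = (g ^ i * c ^ j) ^ 3 :=
        inv_eq_of_mul_eq_one_right (by rw [← pow_succ', h4])
      rw [hinv, pow_succ, pow_two, hword_mul, hword_mul]
      exact ⟨_, _, rfl⟩
  have hreduce : ∀ i j : ℕ, g ^ i * c ^ j = g ^ (i % 4) * c ^ (j % 2) := by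
    intro i j
    rw [← hg, pow_mod_orderOf, pow_eq_pow_of_mod_eq c hc2 (Nat.mod_mod j 2)]
  -- `|A| = 8`
  have hAle : Nat.card A ≤ 8 := by
    have hsurj : Function.Surjective (fun p : Fin 4 × Fin 2 =>
        (⟨g ^ (p.1 : ℕ) * c ^ (p.2 : ℕ), A.mul_mem (A.pow_mem hmemg _) (A.pow_mem hmemc _)⟩ : A)) := by
      rintro ⟨u, hu⟩
      obtain ⟨i, j, rfl⟩ := hA u hu
      exact ⟨(⟨i % 4, Nat.mod_lt _ (by norm_num)⟩, ⟨j % 2, Nat.mod_lt _ (by norm_num)⟩),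
        Subtype.ext (hreduce i j).symm⟩
    simpa using Nat.card_le_card_of_surjective _ hsurj
  have hAge : 8 ≤ Nat.card A := by
    have hinj : Function.Injective (fun p : Fin 4 × Fin 2 =>
        (⟨g ^ (p.1 : ℕ) * c ^ (p.2 : ℕ), A.mul_mem (A.pow_mem hmemg _) (A.pow_mem hmemc _)⟩ : A)) := by
      rintro ⟨⟨i, hi⟩, ⟨j, hj⟩⟩ ⟨⟨i', hi'⟩, ⟨j', hj'⟩⟩ h
      simp only [Subtype.mk.injEq] at h
      -- `c^j (c^j')⁻¹ ∈ ⟨g⟩`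
      have hmem : c ^ j * (c ^ j')⁻¹ ∈ Subgroup.zpowers g := by
        have h1 : c ^ j * (c ^ j')⁻¹ = (g ^ i)⁻¹ * g ^ i' := by
          rw [mul_inv_eq_iff_eq_mul, mul_assoc, ← h, inv_mul_cancel_left]
        rw [h1]
        exact Subgroup.mul_mem _ (Subgroup.inv_mem _ (Subgroup.pow_mem _ (Subgroup.mem_zpowers g) _))
          (Subgroup.pow_mem _ (Subgroup.mem_zpowers g) _)
      have hjj : j = j' := by
        interval_cases j <;> interval_cases j'
        · rfl
        · exfalso; apply hcg
          rw [pow_zero, pow_one, one_mul] at hmem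
          simpa using Subgroup.inv_mem _ hmem
        · exfalso; apply hcg
          simpa using hmem
        · rfl
      subst hjj
      have hii : g ^ i = g ^ i' := mul_right_cancel h
      rw [pow_inj_mod, hg, Nat.mod_eq_of_lt hi, Nat.mod_eq_of_lt hi'] at hii
      subst hii
      rfl
    simpa using Nat.card_le_card_of_injective _ hinj
  have hAcard : Nat.card A = 8 := le_antisymm hAle hAge
  have hidx : A.index = 2 := by
    have h := A.index_mul_card
    rw [hAcard, hcard] at h
    omega
  -- an element outside `A`
  obtain ⟨s, hsA⟩ : ∃ s : G, s ∉ A := by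
    by_contra hall
    simp only [not_exists, not_not] at hall
    have hAtop : A = ⊤ := (Subgroup.eq_top_iff' A).2 hall
    have h16 : Nat.card A = 16 := by rw [hAtop, Subgroup.card_top, hcard]
    omega
  have hdich := mem_or_mul_inv_mem hidx hsA
  have hword_mem : ∀ i j : ℕ, g ^ i * c ^ j ∈ A := fun i j => A.mul_mem (A.pow_mem hmemg i) (A.pow_mem hmemc j)
  -- the conjugate of `g` and the square of `s`
  obtain ⟨a₁, b₁, ha₁, hb₁, hsg⟩ : ∃ a₁ b₁ : ℕ, a₁ < 4 ∧ b₁ < 2 ∧ s * g = g ^ a₁ * c ^ b₁ * s := by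
    rcases hdich (s * g) with h | h
    · exact absurd (by simpa using A.mul_mem h (A.inv_mem hmemg)) hsA
    · obtain ⟨i, j, hij⟩ := hA _ h
      refine ⟨i % 4, j % 2, Nat.mod_lt _ (by norm_num), Nat.mod_lt _ (by norm_num), ?_⟩
      rw [← hreduce, ← hij, inv_mul_cancel_right]
  obtain ⟨a₂, b₂, ha₂, hb₂, hss⟩ : ∃ a₂ b₂ : ℕ, a₂ < 4 ∧ b₂ < 2 ∧ s * s = g ^ a₂ * c ^ b₂ := by
    rcases hdich (s * s) with h | h
    · obtain ⟨i, j, hij⟩ := hA _ h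
      exact ⟨i % 4, j % 2, Nat.mod_lt _ (by norm_num), Nat.mod_lt _ (by norm_num), by rw [← hreduce, ← hij]⟩
    · exact absurd (by simpa using h) hsA
  refine ⟨s, a₁, b₁, a₂, b₂, ha₁, hb₁, ha₂, hb₂, hg, hcg, fun i j h => hsA ?_, hcz s, hsg, hss, ?_, ?_, ?_⟩
  · -- `gⁱ cʲ s = 1` would put `s` in `A`
    rw [eq_inv_of_mul_eq_one_right h]
    exact A.inv_mem (hword_mem i j)
  · -- `a₁` odd: else `(s g s⁻¹)² = 1`
    by_contra hodd
    have heven : g ^ (a₁ + a₁) = 1 := by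
      rw [pow_eq_pow_of_mod_eq g hg4 (a := a₁ + a₁) (b := 0) (by omega), pow_zero]
    have hW : (g ^ a₁ * c ^ b₁) * (g ^ a₁ * c ^ b₁) = 1 := by
      rw [hword_mul, heven, one_mul, pow_eq_pow_of_mod_eq c hc2 (a := b₁ + b₁) (b := 0) (by omega), pow_zero]
    have hconj : s * g * s⁻¹ = g ^ a₁ * c ^ b₁ := by rw [mul_inv_eq_iff_eq_mul, hsg]
    have h1 : s * (g * g) * s⁻¹ = 1 := by
      rw [show s * (g * g) * s⁻¹ = (s * g * s⁻¹) * (s * g * s⁻¹) by group, hconj, hW]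
    rw [mul_inv_eq_one] at h1
    exact hg1 (mul_left_cancel (a := s) (h1.trans (mul_one s).symm))
  · -- `(a₁, b₁) = (1, 0)` would make `G` commutative
    rintro ⟨rfl, rfl⟩
    rw [pow_one, pow_zero, mul_one] at hsg
    have hgs : Commute g s := hsg.symm
    have hcs : Commute c s := (hcz s).symm
    have hwords : ∀ u : G, ∃ i j k : ℕ, u = g ^ i * c ^ j * s ^ k := by
      intro u
      rcases hdich u with h | h
      · obtain ⟨i, j, rfl⟩ := hA u h
        exact ⟨i, j, 0, by rw [pow_zero, mul_one]⟩
      · obtain ⟨i, j, hij⟩ := hA _ h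
        exact ⟨i, j, 1, by rw [pow_one, ← hij, inv_mul_cancel_right]⟩
    have hcomm : ∀ u : G, Commute g u ∧ Commute c u ∧ Commute s u := by
      intro u
      obtain ⟨i, j, k, rfl⟩ := hwords u
      exact ⟨((Commute.pow_right (Commute.refl g) i).mul_right (Commute.pow_right hgcomm j)).mul_right
          (Commute.pow_right hgs k),
        ((Commute.pow_right hgcomm.symm i).mul_right (Commute.pow_right (Commute.refl c) j)).mul_right
          (Commute.pow_right hcs k),
        ((Commute.pow_right hgs.symm i).mul_right (Commute.pow_right hcs.symm j)).mul_right
          (Commute.pow_right (Commute.refl s) k)⟩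
    apply hab
    obtain ⟨i, j, k, rfl⟩ := hwords a
    exact (((Commute.pow_left (hcomm b).1 i).mul_left (Commute.pow_left (hcomm b).2.1 j)).mul_left
      (Commute.pow_left (hcomm b).2.2 k)).eq
  · -- `a₂` even: else `s⁴ = g² ≠ 1`
    by_contra hodd
    have hs4 : s ^ 4 = g ^ 2 := by
      calc s ^ 4 = (s * s) * (s * s) := by rw [show (4 : ℕ) = 2 + 2 by norm_num, pow_add, pow_two]
        _ = g ^ (a₂ + a₂) * c ^ (b₂ + b₂) := by rw [hss, hword_mul]
        _ = g ^ 2 := by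
          rw [pow_eq_pow_of_mod_eq g hg4 (a := a₂ + a₂) (b := 2) (by omega),
            pow_eq_pow_of_mod_eq c hc2 (a := b₂ + b₂) (b := 0) (by omega), pow_zero, mul_one]
    rw [h4 s, pow_two] at hs4
    exact hg1 hs4.symm

end Summit.HodgeConjecture.CorCM.GaloisSixteenStructure
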